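import Mathlib
import Literature.AlgebraicGeometry.Resolution.CobordantGame
import Literature.AlgebraicGeometry.Resolution.CobordantChartCoefficients
import Literature.AlgebraicGeometry.Resolution.CobordantChartPlaneSlice
import Literature.AlgebraicGeometry.Resolution.CobordantTupleGame
import Literature.AlgebraicGeometry.Resolution.FormalCoordinateChange
import Summits.ResolutionOfSingularities.ResolutionOfSingularities.Theorems.WeightedInvariantLocalWeightedDropPlaneBranchDropOfCount
import Summits.ResolutionOfSingularities.ResolutionOfSingularities.Theorems.WeightedInvariantLocalWeightedDropMultiplicityLift
import Summits.ResolutionOfSingularities.ResolutionOfSingularities.Theorems.WeightedInvariantLocalWeightedDropSeparablePointStep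

/-!
# `WeightedInvariant.LocalWeightedDrop`, line `hasse-ridge-face-selection`: the point step on a PURE separable char-2 double point
# `y² + x₀^a x₁^b · y + A₀`, with the successor positions made explicit

Crux item stmt-ResolutionOfSingularities-8899 `LocalWeightedDrop` (route `ResolutionOfSingularities/WeightedInvariant`), serving the
door `WeightedConstruction` stmt-ResolutionOfSingularities-0571.  [OURS · L1 W4.3, chain w43, stub worker 2 (gen 2): infrastructure for
the residual stub S2sP `stub_charTwoSeparablePureWon` (typed sub-cut v2 of S2s, evidence on stmt-8899); NOT a statement of any manuscript.]

* `won_dp1_of_singular_of_recentred'` / `won_dp1_of_pointStep'`: the point step with cleaning of `…SeparablePointStep` with the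
  successor's constant coefficient EXPOSED — the caller is asked to win `y² + A₁' y + (A₀' + A₁' φ + φ²)` for the transported
  `A₀' = (s B₀)|`, `A₁' = (s B₁)|` and EVERY constant-free re-centring `φ` that lands in the position space (the step itself supplies one).
* `eq_linearCoeff_chart` / `slice_zero_pureLinearCoeff` / `slice_one_pureLinearCoeff`: for `A₁ = x₀^a x₁^b` the transported linear
  coefficient at the exceptional point `c` is `s^{a+b-1} · c₀^a (c₁ + x₁')^b` (slot `0`) resp. `s^{a+b-1} · (c₀ + x₁')^a c₁^b` (slot `1`).
* `won_pure_of_pointStep`: THE PURE POINT STEP — `y² + x₀^a x₁^b y + A₀` (`a + b ≥ 2`, `ord A₀ ≥ 3`) is won as soon as the caller wins the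
  re-centred successors at the points `c₀ ≠ 0` (slot `0`, new `A₁' = c₀^a · s^{a+b-1} (c₁ + x₁)^b`) and at the point `c = (0 : c₁)`
  (slot `1`, new `A₁' = c₁^b · s^{a+b-1} x₁^a`); after the unit scaling `won_dp1_unit_iff` these are again PURE positions with exponents
  `(a+b-1, 0)` [`c₀c₁ ≠ 0`], `(a+b-1, b)` [`c₁ = 0`], `(a+b-1, a)` [`c₀ = 0`].
-/

set_option linter.dupNamespace false -- mandated namespace of this single-conjunct summit

namespace Summit.ResolutionOfSingularities.ResolutionOfSingularities.Theorems

open Literature.AlgebraicGeometry.Resolution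
open Literature.AlgebraicGeometry.Resolution.CobordantGame

namespace SepPurePointStep

open MvPowerSeries SepTerminalDoublePoint SepPointStep

variable {k : Type} [Field k]

/-- AFTER THE STEP, RE-CENTRING EXPOSED (characteristic `2`, `k = k̄`): a SINGULAR `y² + A₁' y + A₀'` is won as soon as, for every
constant-free `φ` with `ord (A₀' + A₁'φ + φ²) ≥ 3` (and `ord A₁' ≥ 2`), the re-centred position `y² + A₁' y + (A₀' + A₁'φ + φ²)` is won. -/
theorem won_dp1_of_singular_of_recentred' [CharP k 2] [IsAlgClosed k]
    (hlow : ∀ g : MvPowerSeries (Fin 1) k, CobordantGame.IsSingular k g → CobordantGame.Won k 1 g)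
    {A₀' A₁' : MvPowerSeries (Fin 2) k}
    (hS : CobordantGame.IsSingular k (X (Fin.last 2) ^ 2 + (rename (Fin.succAboveEmb (Fin.last 2)) A₀' +
      rename (Fin.succAboveEmb (Fin.last 2)) A₁' * X (Fin.last 2))))
    (hW : ∀ φ : MvPowerSeries (Fin 2) k, constantCoeff φ = 0 → (2 : ℕ∞) < (A₀' + A₁' * φ + φ ^ 2).order →
      (1 : ℕ∞) < A₁'.order →
      CobordantGame.Won k 3 (X (Fin.last 2) ^ 2 + (rename (Fin.succAboveEmb (Fin.last 2)) (A₀' + A₁' * φ + φ ^ 2) +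
        rename (Fin.succAboveEmb (Fin.last 2)) A₁' * X (Fin.last 2)))) :
    CobordantGame.Won k 3 (X (Fin.last 2) ^ 2 + (rename (Fin.succAboveEmb (Fin.last 2)) A₀' +
      rename (Fin.succAboveEmb (Fin.last 2)) A₁' * X (Fin.last 2))) := by
  classical
  by_cases hl : ∃ l : Fin 2, coeff (Finsupp.single l 1) A₁' ≠ 0
  · obtain ⟨l, hl⟩ := hl
    exact won_dp1_of_coeff_single_A₁_ne_zero hlow hS l hl
  push Not at hl
  by_cases hx : coeff (Finsupp.single 0 1 + Finsupp.single 1 1) A₀' ≠ 0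
  · exact won_dp1_of_coeff_cross_A₀_ne_zero hlow hS hx
  push Not at hx
  have hA₁0 : constantCoeff A₁' = 0 := by rw [← coeff_single_last_dp1 A₀' A₁']; exact hS.2.2 _
  have hA₁ord : (1 : ℕ∞) < A₁'.order := one_lt_order_of_coeff_eq_zero hA₁0 hl
  have hA₀0 : constantCoeff A₀' = 0 := by rw [← constantCoeff_dp1 A₀' A₁']; exact hS.2.1
  have hA₀1 : ∀ l : Fin 2, coeff (Finsupp.single l 1) A₀' = 0 := fun l => by
    rw [← coeff_single_castSucc_dp1 A₀' A₁' l 1]; exact hS.2.2 _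
  obtain ⟨a, ha⟩ := IsAlgClosed.exists_eq_mul_self (coeff (Finsupp.single 0 2) A₀')
  obtain ⟨b, hb⟩ := IsAlgClosed.exists_eq_mul_self (coeff (Finsupp.single 1 2) A₀')
  have hφ0 : constantCoeff (C a * X 0 + C b * X 1 : MvPowerSeries (Fin 2) k) = 0 := by simp [constantCoeff_X]
  have hord := two_lt_order_recentred hA₀0 hA₀1 hx hA₁ord ha hb
  have hWin := hW (C a * X 0 + C b * X 1) hφ0 hord hA₁ord
  have h2φ : A₁' + 2 * (C a * X 0 + C b * X 1) = A₁' := by rw [two_eq_zero, zero_mul, add_zero]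
  refine (won_monic_two_recentre_iff (C a * X 0 + C b * X 1) hφ0 A₀' A₁').mp ?_
  rw [h2φ]
  exact hWin

/-- THE POINT STEP WITH THE SUCCESSOR EXPOSED (characteristic `2`, `k = k̄`; only the singular one-variable germs assumed won).
`y² + A₁ y + A₀` (`ord A₀ ≥ 3`, `ord A₁ ≥ 2`) is won as soon as, for every exceptional point `c ≠ 0` and the factorisations
`A₀ ∘ chart(c) = s³ B₀`, `A₁ ∘ chart(c) = s² B₁`, at SOME live slot `i₀` the caller wins `y² + A₁' y + (A₀' + A₁'φ + φ²)` for
`A₀' = (s B₀)|_{x'_{i₀} ↦ 0}`, `A₁' = (s B₁)|_{x'_{i₀} ↦ 0}` and every constant-free `φ` landing in the position space. -/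
theorem won_dp1_of_pointStep' [CharP k 2] [IsAlgClosed k]
    (hlow : ∀ g : MvPowerSeries (Fin 1) k, CobordantGame.IsSingular k g → CobordantGame.Won k 1 g)
    (A₀ A₁ : MvPowerSeries (Fin 2) k) (h₀ : (2 : ℕ∞) < A₀.order) (h₁ : (1 : ℕ∞) < A₁.order)
    (hsucc : ∀ c : Fin 2 → k, (∃ i, c i ≠ 0) → ∀ B₀ B₁ : MvPowerSeries (Fin 3) k,
      MvPowerSeries.subst (CobordantChart.chart (fun _ : Fin 2 => 1) c) A₀ = MvPowerSeries.X 0 ^ 3 * B₀ →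
      MvPowerSeries.subst (CobordantChart.chart (fun _ : Fin 2 => 1) c) A₁ = MvPowerSeries.X 0 ^ 2 * B₁ →
      ∃ i₀ : Fin 2, c i₀ ≠ 0 ∧ ∀ φ : MvPowerSeries (Fin 2) k, constantCoeff φ = 0 →
        (2 : ℕ∞) < (TupleGame.slice i₀ (X 0 * B₀) + TupleGame.slice i₀ (X 0 * B₁) * φ + φ ^ 2).order →
        (1 : ℕ∞) < (TupleGame.slice i₀ (X 0 * B₁)).order →
        CobordantGame.Won k 3 (X (Fin.last 2) ^ 2 + (rename (Fin.succAboveEmb (Fin.last 2))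
          (TupleGame.slice i₀ (X 0 * B₀) + TupleGame.slice i₀ (X 0 * B₁) * φ + φ ^ 2) +
          rename (Fin.succAboveEmb (Fin.last 2)) (TupleGame.slice i₀ (X 0 * B₁)) * X (Fin.last 2)))) :
    CobordantGame.Won k 3 (X (Fin.last 2) ^ 2 + (rename (Fin.succAboveEmb (Fin.last 2)) A₀ +
      rename (Fin.succAboveEmb (Fin.last 2)) A₁ * X (Fin.last 2))) := by
  classical
  rw [MonicDoublePointLift.monic_two_eq_sum A₀ A₁]
  refine won_monic_of_pointBlowup_slot 2 Nat.prime_two k 2 2 two_pos (![A₀, A₁]) ?_ ?_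
  · intro j
    fin_cases j
    · simpa using h₀
    · simpa using h₁
  · intro c hc B hB
    obtain ⟨i₀, hci₀, hW⟩ := hsucc c hc (B 0) (B 1) (by simpa using hB 0) (by simpa using hB 1)
    refine ⟨i₀, hci₀, fun hS => ?_⟩
    have hSeq : X (Fin.last 2) ^ 2 + ∑ j : Fin 2, rename (Fin.succAboveEmb (Fin.last 2))
        (TupleGame.slice i₀ (X 0 * B j)) * X (Fin.last 2) ^ (j : ℕ) =
        X (Fin.last 2) ^ 2 + (rename (Fin.succAboveEmb (Fin.last 2)) (TupleGame.slice i₀ (X 0 * B 0)) +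
          rename (Fin.succAboveEmb (Fin.last 2)) (TupleGame.slice i₀ (X 0 * B 1)) * X (Fin.last 2)) := by
      rw [Fin.sum_univ_two]
      simp only [Fin.val_zero, Fin.val_one, pow_zero, mul_one, pow_one]
    rw [hSeq] at hS ⊢
    exact won_dp1_of_singular_of_recentred' hlow hS hW

/-! ### The transported linear coefficient of a pure position -/

/-- THE MONOMIAL `x₀^a x₁^b` UNDER THE POINT CHART at `c`: `(s (c₀ + x₁'))^a (s (c₁ + x₂'))^b = s² · B₁` forces
`B₁ = s^{a+b-2} (c₀ + x₁')^a (c₁ + x₂')^b` (`a + b ≥ 2`). -/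
theorem eq_linearCoeff_chart (c : Fin 2 → k) {a b : ℕ} (hab : 2 ≤ a + b) {B₁ : MvPowerSeries (Fin 3) k}
    (hB₁ : subst (CobordantChart.chart (fun _ : Fin 2 => 1) c) (X 0 ^ a * X 1 ^ b : MvPowerSeries (Fin 2) k) = X 0 ^ 2 * B₁) :
    B₁ = X 0 ^ (a + b - 2) * ((C (c 0) + X 1) ^ a * (C (c 1) + X 2) ^ b) := by
  have hconv : ∀ i, (fun _ : Fin 2 => (1 : ℕ)) i = 0 → c i = 0 := fun _ h => absurd h one_ne_zero
  have hs := CobordantChart.hasSubst_chart (fun _ : Fin 2 => 1) c hconv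
  have hsub : subst (CobordantChart.chart (fun _ : Fin 2 => 1) c) (X 0 ^ a * X 1 ^ b : MvPowerSeries (Fin 2) k) =
      X 0 ^ (a + b) * ((C (c 0) + X 1) ^ a * (C (c 1) + X 2) ^ b) := by
    rw [← coe_substAlgHom hs, map_mul, map_pow, map_pow, coe_substAlgHom, subst_X hs, subst_X hs,
      CobordantChart.chart_apply, CobordantChart.chart_apply, pow_one, mul_pow, mul_pow,
      show (Fin.succ (0 : Fin 2) : Fin 3) = 1 from rfl, show (Fin.succ (1 : Fin 2) : Fin 3) = 2 from rfl, pow_add]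
    ring
  have h : X 0 ^ 2 * B₁ = X 0 ^ 2 * (X 0 ^ (a + b - 2) * ((C (c 0) + X 1) ^ a * (C (c 1) + X 2) ^ b)) := by
    obtain ⟨n, hn⟩ : ∃ n, a + b = n + 2 := ⟨a + b - 2, by omega⟩
    rw [← hB₁, hsub, show a + b - 2 = n by omega, hn]
    ring
  exact mul_left_cancel₀ (pow_ne_zero 2 (FormalCoordChange.X_ne_zero' _)) h

/-- Slot `0`: the transported linear coefficient of the pure position is `s^{a+b-1} · (c₀^a (c₁ + x₁)^b)`. -/
theorem slice_zero_pureLinearCoeff (c : Fin 2 → k) {a b : ℕ} (hab : 2 ≤ a + b) {B₁ : MvPowerSeries (Fin 3) k}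
    (hB₁ : subst (CobordantChart.chart (fun _ : Fin 2 => 1) c) (X 0 ^ a * X 1 ^ b : MvPowerSeries (Fin 2) k) = X 0 ^ 2 * B₁) :
    TupleGame.slice 0 (X 0 * B₁) = X 0 ^ (a + b - 1) * (C (c 0 ^ a) * (C (c 1) + X 1) ^ b) := by
  have hsl := CobordantChartPlaneSlice.hasSubst_slice (R := k) (n := 2) 0
  rw [eq_linearCoeff_chart c hab hB₁, show X 0 * (X 0 ^ (a + b - 2) * ((C (c 0) + X 1) ^ a * (C (c 1) + X 2) ^ b)) =
      (X 0 : MvPowerSeries (Fin 3) k) ^ (a + b - 1) * ((C (c 0) + X 1) ^ a * (C (c 1) + X 2) ^ b) by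
        rw [show a + b - 1 = a + b - 2 + 1 by omega, pow_succ]; ring,
    MultiplicityLift.slice_X_zero_pow_mul]
  congr 1
  unfold TupleGame.slice
  rw [← coe_substAlgHom hsl, map_mul, map_pow, map_pow, map_add, map_add, coe_substAlgHom, subst_C, subst_C,
    show (X 1 : MvPowerSeries (Fin 3) k) = X (Fin.succ (0 : Fin 2)) from rfl,
    show (X 2 : MvPowerSeries (Fin 3) k) = X (Fin.succ (1 : Fin 2)) from rfl,
    PlaneBranchDropOfCount.subst_slice_X_succ_self, PlaneBranchDropOfCount.subst_slice_X_succ_of_ne (by decide),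
    add_zero, map_pow]

/-- Slot `1`: the transported linear coefficient of the pure position is `s^{a+b-1} · ((c₀ + x₁)^a c₁^b)`. -/
theorem slice_one_pureLinearCoeff (c : Fin 2 → k) {a b : ℕ} (hab : 2 ≤ a + b) {B₁ : MvPowerSeries (Fin 3) k}
    (hB₁ : subst (CobordantChart.chart (fun _ : Fin 2 => 1) c) (X 0 ^ a * X 1 ^ b : MvPowerSeries (Fin 2) k) = X 0 ^ 2 * B₁) :
    TupleGame.slice 1 (X 0 * B₁) = X 0 ^ (a + b - 1) * ((C (c 0) + X 1) ^ a * C (c 1 ^ b)) := by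
  have hsl := CobordantChartPlaneSlice.hasSubst_slice (R := k) (n := 2) 1
  rw [eq_linearCoeff_chart c hab hB₁, show X 0 * (X 0 ^ (a + b - 2) * ((C (c 0) + X 1) ^ a * (C (c 1) + X 2) ^ b)) =
      (X 0 : MvPowerSeries (Fin 3) k) ^ (a + b - 1) * ((C (c 0) + X 1) ^ a * (C (c 1) + X 2) ^ b) by
        rw [show a + b - 1 = a + b - 2 + 1 by omega, pow_succ]; ring,
    MultiplicityLift.slice_X_zero_pow_mul]
  congr 1
  unfold TupleGame.slice
  rw [← coe_substAlgHom hsl, map_mul, map_pow, map_pow, map_add, map_add, coe_substAlgHom, subst_C, subst_C,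
    show (X 1 : MvPowerSeries (Fin 3) k) = X (Fin.succ (0 : Fin 2)) from rfl,
    show (X 2 : MvPowerSeries (Fin 3) k) = X (Fin.succ (1 : Fin 2)) from rfl,
    PlaneBranchDropOfCount.subst_slice_X_succ_self, PlaneBranchDropOfCount.subst_slice_X_succ_of_ne (by decide),
    add_zero, map_pow]

/-- THE PURE POINT STEP (characteristic `2`, `k = k̄`; only the singular one-variable germs assumed won).  The pure position
`y² + x₀^a x₁^b · y + A₀` (`a + b ≥ 2`, `ord A₀ ≥ 3`) is won as soon as the caller wins, for every constant-free re-centring `φ` landing in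
the position space,
* at every exceptional point with `c₀ ≠ 0` (slot `0`; `A₀ ∘ chart(c) = s³ B₀`): `y² + A₁' y + ((s B₀)|₀ + A₁'φ + φ²)` with
  `A₁' = s^{a+b-1} · c₀^a (c₁ + x₁)^b`;
* at the exceptional point `c = (0 : c₁)`, `c₁ ≠ 0` (slot `1`): the same with `A₁' = s^{a+b-1} · x₁^a c₁^b` and `(s B₀)|₁`. -/
theorem won_pure_of_pointStep [CharP k 2] [IsAlgClosed k]
    (hlow : ∀ g : MvPowerSeries (Fin 1) k, CobordantGame.IsSingular k g → CobordantGame.Won k 1 g)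
    (a b : ℕ) (hab : 2 ≤ a + b) (A₀ : MvPowerSeries (Fin 2) k) (h₀ : (2 : ℕ∞) < A₀.order)
    (hS0 : ∀ c : Fin 2 → k, c 0 ≠ 0 → ∀ B₀ : MvPowerSeries (Fin 3) k,
      MvPowerSeries.subst (CobordantChart.chart (fun _ : Fin 2 => 1) c) A₀ = MvPowerSeries.X 0 ^ 3 * B₀ →
      ∀ φ : MvPowerSeries (Fin 2) k, constantCoeff φ = 0 →
        (2 : ℕ∞) < (TupleGame.slice 0 (X 0 * B₀) + X 0 ^ (a + b - 1) * (C (c 0 ^ a) * (C (c 1) + X 1) ^ b) * φ + φ ^ 2).order →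
        (1 : ℕ∞) < (X 0 ^ (a + b - 1) * (C (c 0 ^ a) * (C (c 1) + X 1) ^ b) : MvPowerSeries (Fin 2) k).order →
        CobordantGame.Won k 3 (X (Fin.last 2) ^ 2 + (rename (Fin.succAboveEmb (Fin.last 2))
          (TupleGame.slice 0 (X 0 * B₀) + X 0 ^ (a + b - 1) * (C (c 0 ^ a) * (C (c 1) + X 1) ^ b) * φ + φ ^ 2) +
          rename (Fin.succAboveEmb (Fin.last 2)) (X 0 ^ (a + b - 1) * (C (c 0 ^ a) * (C (c 1) + X 1) ^ b)) * X (Fin.last 2))))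
    (hS1 : ∀ c : Fin 2 → k, c 0 = 0 → c 1 ≠ 0 → ∀ B₀ : MvPowerSeries (Fin 3) k,
      MvPowerSeries.subst (CobordantChart.chart (fun _ : Fin 2 => 1) c) A₀ = MvPowerSeries.X 0 ^ 3 * B₀ →
      ∀ φ : MvPowerSeries (Fin 2) k, constantCoeff φ = 0 →
        (2 : ℕ∞) < (TupleGame.slice 1 (X 0 * B₀) + X 0 ^ (a + b - 1) * (X 1 ^ a * C (c 1 ^ b)) * φ + φ ^ 2).order →
        (1 : ℕ∞) < (X 0 ^ (a + b - 1) * (X 1 ^ a * C (c 1 ^ b)) : MvPowerSeries (Fin 2) k).order →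
        CobordantGame.Won k 3 (X (Fin.last 2) ^ 2 + (rename (Fin.succAboveEmb (Fin.last 2))
          (TupleGame.slice 1 (X 0 * B₀) + X 0 ^ (a + b - 1) * (X 1 ^ a * C (c 1 ^ b)) * φ + φ ^ 2) +
          rename (Fin.succAboveEmb (Fin.last 2)) (X 0 ^ (a + b - 1) * (X 1 ^ a * C (c 1 ^ b))) * X (Fin.last 2)))) :
    CobordantGame.Won k 3 (X (Fin.last 2) ^ 2 + (rename (Fin.succAboveEmb (Fin.last 2)) A₀ +
      rename (Fin.succAboveEmb (Fin.last 2)) (X 0 ^ a * X 1 ^ b) * X (Fin.last 2))) := by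
  classical
  have h₁ : (1 : ℕ∞) < (X 0 ^ a * X 1 ^ b : MvPowerSeries (Fin 2) k).order := by
    have h := PlaneBranchDropOfCount.order_unit_monomial (k := k) (u := 1) (by simp) a b
    rw [one_mul] at h
    rw [h]
    exact_mod_cast hab
  refine won_dp1_of_pointStep' hlow A₀ _ h₀ h₁ fun c hc B₀ B₁ hB₀ hB₁ => ?_
  by_cases hc0 : c 0 ≠ 0
  · refine ⟨0, hc0, fun φ hφ hord hA₁ => ?_⟩
    rw [slice_zero_pureLinearCoeff c hab hB₁] at hord hA₁ ⊢
    exact hS0 c hc0 B₀ hB₀ φ hφ hord hA₁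
  · push Not at hc0
    have hc1 : c 1 ≠ 0 := by
      obtain ⟨i, hi⟩ := hc
      fin_cases i
      · exact absurd hc0 hi
      · exact hi
    refine ⟨1, hc1, fun φ hφ hord hA₁ => ?_⟩
    rw [slice_one_pureLinearCoeff c hab hB₁, hc0, map_zero, zero_add] at hord hA₁ ⊢
    exact hS1 c hc0 hc1 B₀ hB₀ φ hφ hord hA₁

end SepPurePointStep

end Summit.ResolutionOfSingularities.ResolutionOfSingularities.Theorems
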